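import Mathlib
import Summits.ValiantsHypothesis.ValiantsHypothesis.Theses.FeketeSOS

/-!
# `FeketeSOS.FeketeBoundedFanin` (stmt-ValiantsHypothesis-3998) is a corollary of the route's thesis
`FeketeSOS.FeketeSOSHard` (stmt-ValiantsHypothesis-3996)

Route rev 2 of `FeketeSOS` records item 3998 (bounded top fan-in `s₀`) as a support item, "necessary condition of
X"; this file is the checked form of that remark: X = `FeketeSOSHard` bounds the support-sum of every weighted SOS
representation of `F_p` with `s ≤ p^δ` squares of degree `≤ p²`, and for fixed `s₀` one has `s₀ ≤ p^δ` as soon as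
`p ≥ ⌈s₀^{1/δ}⌉`.  CONDITIONAL result (hypothesis `hX`); the line lead's registered skeleton
`Cruxes/FeketeBoundedFanin/Lines/witt_pascal_ufa.lean` (reshape r3) contains the unconditional attempts.
-/

namespace Summit.ValiantsHypothesis.ValiantsHypothesis.Theorems.FeketeBoundedFaninWPU

open Summit.ValiantsHypothesis.ValiantsHypothesis.Theses

-- `Summit.ValiantsHypothesis.ValiantsHypothesis.…` is the tree's mandated single-conjunct layout (Sub = Summit).
set_option linter.dupNamespace false

/-- **X ⟹ bounded fan-in.**  `FeketeSOSHard → FeketeBoundedFanin`: take the same `δ` and the threshold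
`max(p₀, ⌈s₀^{1/δ}⌉)`, beyond which `s₀ ≤ p^δ`. [folklore] -/
theorem feketeBoundedFanin_of_feketeSOSHard (hX : FeketeSOS.FeketeSOSHard) : FeketeSOS.FeketeBoundedFanin := by
  intro s₀
  obtain ⟨δ, hδ, p₀, h⟩ := hX
  obtain ⟨p₂, hp₂⟩ : ∃ p₂ : ℕ, ((s₀ : ℝ)) ^ (1 / δ) ≤ (p₂ : ℝ) := ⟨⌈((s₀ : ℝ)) ^ (1 / δ)⌉₊, Nat.le_ceil _⟩
  refine ⟨δ, hδ, max p₀ p₂, ?_⟩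
  intro p _ hp c g hdeg hrep
  have hp0 : p₀ ≤ p := (le_max_left _ _).trans hp
  have hp2 : p₂ ≤ p := (le_max_right _ _).trans hp
  have hs : (s₀ : ℝ) ≤ (p : ℝ) ^ δ := by
    have hs0 : (0 : ℝ) ≤ (s₀ : ℝ) := Nat.cast_nonneg _
    have h1 : (((s₀ : ℝ)) ^ (1 / δ)) ^ δ = (s₀ : ℝ) := by
      rw [← Real.rpow_mul hs0, show (1 / δ) * δ = (1 : ℝ) by field_simp, Real.rpow_one]
    rw [← h1]
    exact Real.rpow_le_rpow (Real.rpow_nonneg hs0 _) (hp₂.trans (by exact_mod_cast hp2)) hδ.le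
  exact h p hp0 s₀ c g hs hdeg hrep

end Summit.ValiantsHypothesis.ValiantsHypothesis.Theorems.FeketeBoundedFaninWPU
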